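import Mathlib
import HarnessLib
import Summits.HubbardSuperconductivity.HubbardSuperconductivity.Theorems.KLProgrammeKLRegimeEngineFrameShiftMomentResponseCT
import Summits.HubbardSuperconductivity.HubbardSuperconductivity.Theorems.KLProgrammeKLRegimeEngineBareVertexReadingString

/-!
# K3 gen-8-FLOW (stmt 20437, stub (C), located risk «(C)-B-REP» item (β), step 2): the moment-form covariance-response door for the vertex
# `V_U + 𝒩_K` with the BARE TADPOLE SPLIT OFF SIGNED

Cell gate-hubbard-kl, seat p2 g12; pen ruling (R59c) (β).  In the loop term `6·Σ_A Ċ(A,Ā)·𝒲₄(X,Ā,A)` of the response door the four-leg kernel is split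
`𝒲₄ = F₄[V_U] + R₄`.  By `…EngineBareVertexReadingString` the bare kernel at the loop strings is `[A.1.2 ≠ σ]·(±)·U/(βL²)³/4!`, independent of the
external momentum and of `A`'s frequency–momentum, so `Σ_A Ċ(A,Ā)·F₄[V_U](X_{k⃗},Ā,A) = −(2u)·Σ_p Σ_{τ ≠ σ} ṡ(p,τ)` (`u = U/(βL²)³·(4!)⁻¹`) — a SIGNED
symbol sum, constant in `k⃗` (its inverse transform sits at `x = 0`).  Hence:

* `torusFourierInv_const`, `sum_weight_norm_torusFourierInv_const` — `𝔉⁻¹[const c](x) = c·[x = 0]`, moment `= w(0)·‖c‖`;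
* `kernel_hubbardInteraction_readingString_eq`, `sum_normalCovariance_mul_bare_eq` — the bare kernel as an explicit `ite` and its contraction with `Ċ`;
* `covResp_moment_kernel_two_laplacian_le_split` — loop ≤ `12·(Σ_p‖ṡ p‖)·N₂ + w(0)·(|U|/|βL²|³)·Ss` with `N₂` the moments of the `R₄` data and `‖Σ_p ṡ(p,τ)‖ ≤ Ss`;
* **`covRespCT_moment_kernel_two_sub_le_split`** — `Σ_x w‖𝔉⁻¹[𝒲′[s₁]₂ − 𝒲′[s₀]₂]‖ ≤ 12·(Σ‖s₁−s₀‖)·N₂ + w(0)·(|U|/|βL²|³)·Ss + 2·D·S²`: `N₂` is O(U²)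
  (four-leg kernel minus bare), `Ss` is read by `…EngineFrameShiftDensityResponse.norm_sum_uvSymbolCT_sub_le_signed` (O(βL²·β·L²·fd)), the entry sum by
  `…SymbolL1Sharp`, and `S` is the renormalised two-leg kernel of the countertermed action.

Proofs only; nothing about the sizes is asserted; nothing asserts superconductivity.  References: Salmhofer 1998 §3.1; BGM 2006 §2.1 (2.6a), §3 (3.3)
[cite: BenfattoGiulianiMastropietro2006].
-/

noncomputable section

namespace Summit.HubbardSuperconductivity.HubbardSuperconductivity.Theorems.EngineV8

set_option linter.dupNamespace false -- summit = problem name (single-conjunct summit), D-0017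

open Finset Literature.MathematicalPhysics.QuantumLattice Literature.Probability.LatticeModels GrassmannAlgebra
open Summit.HubbardSuperconductivity.HubbardSuperconductivity.Theorems.KLRegimeSplit
open Summit.HubbardSuperconductivity.HubbardSuperconductivity.Theorems.TwoVolumeDefect
open scoped ComplexConjugate

variable {L M : ℕ} [NeZero L]

/-! ## §1 Inverse transform of a constant -/

/-- `𝔉⁻¹[k⃗ ↦ c](x) = c·[x = 0]`. -/
theorem torusFourierInv_const (c : ℂ) (x : TorusSite 2 L) : torusFourierInv (fun _ : TorusSite 2 L => c) x = if x = 0 then c else 0 := by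
  classical
  rw [torusFourierInv_eq_sum_torusChar, ← mul_sum, sum_torusChar_left]
  have hL : (L : ℂ) ≠ 0 := by exact_mod_cast NeZero.ne L
  split_ifs with h
  · field_simp
  · rw [mul_zero, mul_zero]

/-- The moment of a constant datum: `Σ_x w(x)‖𝔉⁻¹[const c](x)‖ = w(0)·‖c‖`. -/
theorem sum_weight_norm_torusFourierInv_const (w : TorusSite 2 L → ℝ) (c : ℂ) :
    ∑ x : TorusSite 2 L, w x * ‖torusFourierInv (fun _ : TorusSite 2 L => c) x‖ = w 0 * ‖c‖ := by
  classical
  simp_rw [torusFourierInv_const]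
  rw [Finset.sum_eq_single (0 : TorusSite 2 L) (fun x _ hx => by rw [if_neg hx, norm_zero, mul_zero]) (fun h => absurd (mem_univ _) h),
    if_pos rfl]

/-! ## §2 The bare kernel at the loop strings, explicitly, and its contraction with `Ċ` -/

/-- **The bare kernel at the loop strings as an explicit function of `(σ, A.1.2, A.2)`**. -/
theorem kernel_hubbardInteraction_readingString_eq (β U : ℝ) (K : FreqMomentum L M) (σ : Fin 2) (A : HubbardFieldIdx L M) :
    kernel ℂ (hubbardInteraction L M β U) 4
        (Fin.snoc (Fin.snoc ![(((K, σ), 0) : HubbardFieldIdx L M), ((K, σ), 1)] (A.1, 1 - A.2) : Fin 3 → HubbardFieldIdx L M) A) =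
      if A.1.2 = σ then 0 else
        (if A.2 = 1 then (1 : ℂ) else -1) * ((((U / (β * (L : ℝ) ^ 2) ^ 3 : ℝ)) : ℂ) * (((4 : ℕ).factorial : ℚ)⁻¹ • (1 : ℂ))) := by
  obtain ⟨⟨p, τ⟩, c⟩ := A
  by_cases hτ : τ = σ
  · rw [if_pos hτ]
    exact kernel_hubbardInteraction_readingString_of_spin_eq β U K σ ((p, τ), c) hτ
  · rw [if_neg hτ]
    fin_cases σ <;> fin_cases τ <;> first | exact absurd rfl hτ | skip
    · fin_cases c
      · show kernel ℂ (hubbardInteraction L M β U) 4 (Fin.snoc (Fin.snoc ![(((K, (0 : Fin 2)), 0) : HubbardFieldIdx L M), ((K, 0), 1)]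
          ((p, 1), 1 - 0) : Fin 3 → HubbardFieldIdx L M) (((p, 1), 0) : HubbardFieldIdx L M)) = _
        rw [kernel_hubbardInteraction_readingString_up_zero]; simp
      · show kernel ℂ (hubbardInteraction L M β U) 4 (Fin.snoc (Fin.snoc ![(((K, (0 : Fin 2)), 0) : HubbardFieldIdx L M), ((K, 0), 1)]
          ((p, 1), 1 - 1) : Fin 3 → HubbardFieldIdx L M) (((p, 1), 1) : HubbardFieldIdx L M)) = _
        rw [kernel_hubbardInteraction_readingString_up_one]; simp
    · fin_cases c
      · show kernel ℂ (hubbardInteraction L M β U) 4 (Fin.snoc (Fin.snoc ![(((K, (1 : Fin 2)), 0) : HubbardFieldIdx L M), ((K, 1), 1)]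
          ((p, 0), 1 - 0) : Fin 3 → HubbardFieldIdx L M) (((p, 0), 0) : HubbardFieldIdx L M)) = _
        rw [kernel_hubbardInteraction_readingString_down_zero]; simp
      · show kernel ℂ (hubbardInteraction L M β U) 4 (Fin.snoc (Fin.snoc ![(((K, (1 : Fin 2)), 0) : HubbardFieldIdx L M), ((K, 1), 1)]
          ((p, 0), 1 - 1) : Fin 3 → HubbardFieldIdx L M) (((p, 0), 1) : HubbardFieldIdx L M)) = _
        rw [kernel_hubbardInteraction_readingString_down_one]; simp

/-- **The bare term contracted with `Ċ = normalCovariance ṡ`**: `Σ_A Ċ(A,Ā)·F₄[V_U](X_K,Ā,A) = −2u·Σ_{(p,τ)} [τ ≠ σ]·ṡ(p,τ)`, `u = U/(βL²)³·(4!)⁻¹`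
— independent of `K`. -/
theorem sum_normalCovariance_mul_bare_eq (sdot : FreqMomentum L M × Fin 2 → ℂ) (β U : ℝ) (K : FreqMomentum L M) (σ : Fin 2) :
    ∑ A : HubbardFieldIdx L M, normalCovariance L M sdot A (A.1, 1 - A.2) *
        kernel ℂ (hubbardInteraction L M β U) 4
          (Fin.snoc (Fin.snoc ![(((K, σ), 0) : HubbardFieldIdx L M), ((K, σ), 1)] (A.1, 1 - A.2) : Fin 3 → HubbardFieldIdx L M) A) =
      -2 * ((((U / (β * (L : ℝ) ^ 2) ^ 3 : ℝ)) : ℂ) * (((4 : ℕ).factorial : ℚ)⁻¹ • (1 : ℂ))) *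
        ∑ pt : FreqMomentum L M × Fin 2, if pt.2 = σ then 0 else sdot pt := by
  simp_rw [kernel_hubbardInteraction_readingString_eq]
  rw [Fintype.sum_prod_type, mul_sum]
  refine sum_congr rfl fun pt _ => ?_
  rw [Fin.sum_univ_two]
  dsimp only
  have h10 : ((1 : Fin 2) - 0) = 1 := by decide
  have h11 : ((1 : Fin 2) - 1) = 0 := by decide
  rw [h10, h11, (normalCovariance_bar sdot pt).1, (normalCovariance_bar sdot pt).2, if_neg (show (0 : Fin 2) ≠ 1 by decide),
    if_pos (rfl : (1 : Fin 2) = 1)]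
  split_ifs <;> ring

/-! ## §3 The loop term with the bare vertex split off -/

/-- **LOOP TERM, BARE VERTEX SPLIT OFF SIGNED**: with `R₄ := 𝒲₄ − F₄[V_U]` at the loop strings (moments `≤ N₂` for every `A`) and `‖Σ_p ṡ(p,τ)‖ ≤ Ss`
(every spin `τ`): `Σ_x w(x)‖𝔉⁻¹[k⃗ ↦ kernel (Δ_Ċ 𝒲) 2 X_{(ω_i,k⃗,σ)}](x)‖ ≤ 12·(Σ_p‖ṡ p‖)·N₂ + w(0)·(|U|/|βL²|³)·Ss`. -/
theorem covResp_moment_kernel_two_laplacian_le_split (sdot : FreqMomentum L M × Fin 2 → ℂ) (W : HubbardGrassmann L M) (β U : ℝ)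
    (i : MatsubaraIdx M) (σ : Fin 2) {w : TorusSite 2 L → ℝ} (hw0 : ∀ x, 0 ≤ w x) {N₂ Ss : ℝ}
    (hN₂ : ∀ A : HubbardFieldIdx L M, ∑ x, w x * ‖torusFourierInv (fun kv : TorusSite 2 L =>
      kernel ℂ W 4 (Fin.snoc (Fin.snoc ![((((i, kv), σ), 0) : HubbardFieldIdx L M), (((i, kv), σ), 1)] (A.1, 1 - A.2) :
        Fin 3 → HubbardFieldIdx L M) A) -
      kernel ℂ (hubbardInteraction L M β U) 4 (Fin.snoc (Fin.snoc ![((((i, kv), σ), 0) : HubbardFieldIdx L M), (((i, kv), σ), 1)] (A.1, 1 - A.2) :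
        Fin 3 → HubbardFieldIdx L M) A)) x‖ ≤ N₂)
    (hSs : ∀ τ : Fin 2, ‖∑ p : FreqMomentum L M, sdot (p, τ)‖ ≤ Ss) :
    ∑ x, w x * ‖torusFourierInv (fun kv : TorusSite 2 L =>
        kernel ℂ (grassmannLaplacian ℂ (normalCovariance L M sdot) W) 2 ![((((i, kv), σ), 0) : HubbardFieldIdx L M), (((i, kv), σ), 1)]) x‖ ≤
      12 * (∑ p, ‖sdot p‖) * N₂ + w 0 * (|U| / |β * (L : ℝ) ^ 2| ^ 3) * Ss := by
  classical
  set c₆ : ℂ := ((((2 + 1) * (2 + 2) : ℕ) : ℚ) / 2) • (1 : ℂ) with hc₆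
  set u : ℂ := (((U / (β * (L : ℝ) ^ 2) ^ 3 : ℝ)) : ℂ) * (((4 : ℕ).factorial : ℚ)⁻¹ • (1 : ℂ)) with hu
  -- strings and data
  set X : TorusSite 2 L → HubbardFieldIdx L M → Fin 4 → HubbardFieldIdx L M := fun kv A =>
    Fin.snoc (Fin.snoc ![((((i, kv), σ), 0) : HubbardFieldIdx L M), (((i, kv), σ), 1)] (A.1, 1 - A.2) : Fin 3 → HubbardFieldIdx L M) A with hX
  set R : HubbardFieldIdx L M → TorusSite 2 L → ℂ := fun A kv => kernel ℂ W 4 (X kv A) - kernel ℂ (hubbardInteraction L M β U) 4 (X kv A) with hR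
  set Bsum : ℂ := ∑ pt : FreqMomentum L M × Fin 2, if pt.2 = σ then 0 else sdot pt with hBsum
  -- the loop kernel, split
  have hker : ∀ kv : TorusSite 2 L,
      kernel ℂ (grassmannLaplacian ℂ (normalCovariance L M sdot) W) 2 ![((((i, kv), σ), 0) : HubbardFieldIdx L M), (((i, kv), σ), 1)] =
        c₆ * (∑ A : HubbardFieldIdx L M, normalCovariance L M sdot A (A.1, 1 - A.2) * R A kv) + c₆ * (-2 * u * Bsum) := by
    intro kv
    rw [kernel_grassmannLaplacian, ← hc₆, ← mul_add]
    congr 1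
    have hA : ∀ A : HubbardFieldIdx L M, ∑ B, normalCovariance L M sdot A B * kernel ℂ W (2 + 2)
        (Fin.snoc (Fin.snoc ![((((i, kv), σ), 0) : HubbardFieldIdx L M), (((i, kv), σ), 1)] B : Fin 3 → HubbardFieldIdx L M) A) =
        normalCovariance L M sdot A (A.1, 1 - A.2) * kernel ℂ W 4 (X kv A) := fun A =>
      Finset.sum_eq_single (A.1, 1 - A.2) (fun B _ hB => by rw [normalCovariance_eq_zero_of_ne_bar sdot A B hB, zero_mul])
        (fun h => absurd (mem_univ _) h)
    simp_rw [hA]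
    rw [← sum_normalCovariance_mul_bare_eq sdot β U (i, kv) σ, ← sum_add_distrib]
    refine sum_congr rfl fun A _ => ?_
    rw [hR]
    ring
  have hc6 : c₆ = 6 := by
    rw [hc₆, Rat.smul_one_eq_cast]; push_cast; norm_num
  have hc6n : ‖c₆‖ = 6 := by
    rw [hc6]; exact RCLike.norm_ofNat 6
  -- moments: triangle between the remainder part and the constant bare part
  have hsplit : ∀ x, w x * ‖torusFourierInv (fun kv : TorusSite 2 L =>
      kernel ℂ (grassmannLaplacian ℂ (normalCovariance L M sdot) W) 2 ![((((i, kv), σ), 0) : HubbardFieldIdx L M), (((i, kv), σ), 1)]) x‖ ≤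
      6 * (w x * ‖torusFourierInv (fun kv : TorusSite 2 L => ∑ A : HubbardFieldIdx L M, normalCovariance L M sdot A (A.1, 1 - A.2) * R A kv) x‖) +
      6 * (w x * ‖torusFourierInv (fun _ : TorusSite 2 L => -2 * u * Bsum) x‖) := by
    intro x
    simp_rw [hker]
    rw [torusFourierInv_add, show (fun kv : TorusSite 2 L => c₆ * ∑ A : HubbardFieldIdx L M, normalCovariance L M sdot A (A.1, 1 - A.2) * R A kv) =
        fun kv => c₆ * (fun kv' => ∑ A : HubbardFieldIdx L M, normalCovariance L M sdot A (A.1, 1 - A.2) * R A kv') kv from rfl,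
      torusFourierInv_const_mul, torusFourierInv_const_mul]
    calc w x * ‖c₆ * torusFourierInv (fun kv' => ∑ A : HubbardFieldIdx L M, normalCovariance L M sdot A (A.1, 1 - A.2) * R A kv') x +
          c₆ * torusFourierInv (fun _ : TorusSite 2 L => -2 * u * Bsum) x‖
        ≤ w x * (‖c₆ * torusFourierInv (fun kv' => ∑ A : HubbardFieldIdx L M, normalCovariance L M sdot A (A.1, 1 - A.2) * R A kv') x‖ +
          ‖c₆ * torusFourierInv (fun _ : TorusSite 2 L => -2 * u * Bsum) x‖) := mul_le_mul_of_nonneg_left (norm_add_le _ _) (hw0 x)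
      _ = _ := by rw [norm_mul, norm_mul, hc6n]; ring
  refine (sum_le_sum fun x _ => hsplit x).trans ?_
  rw [sum_add_distrib, ← mul_sum, ← mul_sum, sum_weight_norm_torusFourierInv_const]
  -- remainder part
  have hrem := sum_mul_norm_torusFourierInv_sum_le_of_le (Finset.univ : Finset (HubbardFieldIdx L M))
    (fun A => normalCovariance L M sdot A (A.1, 1 - A.2)) (fun A kv => R A kv) hw0 (fun A _ => hN₂ A)
  rw [sum_norm_normalCovariance_bar sdot] at hrem
  -- bare part
  have hB : ‖Bsum‖ ≤ 2 * Ss := by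
    rw [hBsum, Fintype.sum_prod_type]
    dsimp only
    rw [sum_comm]
    calc ‖∑ τ : Fin 2, ∑ p : FreqMomentum L M, (if τ = σ then (0 : ℂ) else sdot (p, τ))‖
        ≤ ∑ τ : Fin 2, ‖∑ p : FreqMomentum L M, (if τ = σ then (0 : ℂ) else sdot (p, τ))‖ := norm_sum_le _ _
      _ ≤ ∑ _τ : Fin 2, Ss := sum_le_sum fun τ _ => by
          by_cases hτ : τ = σ
          · simp only [hτ, if_true, sum_const_zero, norm_zero]
            exact (norm_nonneg _).trans (hSs σ)
          · simp only [hτ, if_false]; exact hSs τ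
      _ = 2 * Ss := by rw [sum_const, card_univ, Fintype.card_fin]; ring
  have hu_norm : ‖u‖ = |U| / |β * (L : ℝ) ^ 2| ^ 3 / 24 := by
    rw [hu, norm_mul, Complex.norm_real, Real.norm_eq_abs, abs_div, abs_pow]
    norm_num [Nat.factorial]
    ring
  have hbare : 6 * (w 0 * ‖-2 * u * Bsum‖) ≤ w 0 * (|U| / |β * (L : ℝ) ^ 2| ^ 3) * Ss := by
    rw [norm_mul, norm_mul, norm_neg, RCLike.norm_ofNat, hu_norm]
    have hw := hw0 0
    have hSs0 : 0 ≤ Ss := (norm_nonneg _).trans (hSs σ)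
    have : 6 * (w 0 * (2 * (|U| / |β * (L : ℝ) ^ 2| ^ 3 / 24) * ‖Bsum‖)) ≤ 6 * (w 0 * (2 * (|U| / |β * (L : ℝ) ^ 2| ^ 3 / 24) * (2 * Ss))) := by
      gcongr
    refine this.trans (le_of_eq ?_)
    ring
  calc 6 * ∑ x, w x * ‖torusFourierInv (fun kv' => ∑ A : HubbardFieldIdx L M, normalCovariance L M sdot A (A.1, 1 - A.2) * R A kv') x‖ +
        6 * (w 0 * ‖-2 * u * Bsum‖)
      ≤ 6 * ((2 * ∑ p, ‖sdot p‖) * N₂) + w 0 * (|U| / |β * (L : ℝ) ^ 2| ^ 3) * Ss := add_le_add (mul_le_mul_of_nonneg_left hrem (by norm_num)) hbare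
    _ = 12 * (∑ p, ‖sdot p‖) * N₂ + w 0 * (|U| / |β * (L : ℝ) ^ 2| ^ 3) * Ss := by ring

/-! ## §4 The door with the split loop -/

/-- **THE MOMENT-FORM RESPONSE DOOR FOR `V_U + 𝒩_K`, BARE TADPOLE SPLIT OFF SIGNED.** -/
theorem covRespCT_moment_kernel_two_sub_le_split (s₀ s₁ : FreqMomentum L M × Fin 2 → ℂ) (β U : ℝ) (K : TrigPolyC4v) (i : MatsubaraIdx M) (σ : Fin 2)
    {w : TorusSite 2 L → ℝ} (hw0 : ∀ x, 0 ≤ w x) (hw : ∀ x y, w (x + y) ≤ w x * w y)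
    (hZ : ∀ t ∈ Set.Icc (0 : ℝ) 1, effPartitionFn ℂ (normalCovariance L M s₀ + ((t : ℂ)) • (normalCovariance L M s₁ - normalCovariance L M s₀))
      (hubbardInteraction L M β U + counterQuadratic L M β K) ≠ 0)
    {N₂ Ss S D : ℝ}
    (hN₂ : ∀ t ∈ Set.Icc (0 : ℝ) 1, ∀ A : HubbardFieldIdx L M, ∑ x, w x * ‖torusFourierInv (fun kv : TorusSite 2 L =>
      kernel ℂ (effAction ℂ (normalCovariance L M s₀ + ((t : ℂ)) • (normalCovariance L M s₁ - normalCovariance L M s₀))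
        (hubbardInteraction L M β U + counterQuadratic L M β K)) 4
        (Fin.snoc (Fin.snoc ![((((i, kv), σ), 0) : HubbardFieldIdx L M), (((i, kv), σ), 1)] (A.1, 1 - A.2) : Fin 3 → HubbardFieldIdx L M) A) -
      kernel ℂ (hubbardInteraction L M β U) 4
        (Fin.snoc (Fin.snoc ![((((i, kv), σ), 0) : HubbardFieldIdx L M), (((i, kv), σ), 1)] (A.1, 1 - A.2) : Fin 3 → HubbardFieldIdx L M) A)) x‖ ≤ N₂)
    (hSs : ∀ τ : Fin 2, ‖∑ p : FreqMomentum L M, (s₁ (p, τ) - s₀ (p, τ))‖ ≤ Ss)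
    (hS : ∀ t ∈ Set.Icc (0 : ℝ) 1, ∑ x, w x * ‖torusFourierInv (fun kv : TorusSite 2 L =>
      kernel ℂ (effAction ℂ (normalCovariance L M s₀ + ((t : ℂ)) • (normalCovariance L M s₁ - normalCovariance L M s₀))
        (hubbardInteraction L M β U + counterQuadratic L M β K)) 2 ![((((i, kv), σ), 0) : HubbardFieldIdx L M), (((i, kv), σ), 1)]) x‖ ≤ S)
    (hD : ∑ x, w x * ‖torusFourierInv (fun kv : TorusSite 2 L => s₁ ((i, kv), σ) - s₀ ((i, kv), σ)) x‖ ≤ D) :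
    ∑ x, w x * ‖torusFourierInv (fun kv : TorusSite 2 L =>
        kernel ℂ (effAction ℂ (normalCovariance L M s₁) (hubbardInteraction L M β U + counterQuadratic L M β K)) 2
            ![((((i, kv), σ), 0) : HubbardFieldIdx L M), (((i, kv), σ), 1)] -
          kernel ℂ (effAction ℂ (normalCovariance L M s₀) (hubbardInteraction L M β U + counterQuadratic L M β K)) 2
            ![((((i, kv), σ), 0) : HubbardFieldIdx L M), (((i, kv), σ), 1)]) x‖ ≤
      12 * (∑ p, ‖s₁ p - s₀ p‖) * N₂ + w 0 * (|U| / |β * (L : ℝ) ^ 2| ^ 3) * Ss + 2 * D * S ^ 2 := by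
  classical
  letI : LinearOrder (HubbardFieldIdx L M) := LinearOrder.lift' (Fintype.equivFin _) (Fintype.equivFin _).injective
  -- reading strings and two-leg data
  set X : TorusSite 2 L → Fin 2 → HubbardFieldIdx L M := fun kv => ![((((i, kv), σ), 0) : HubbardFieldIdx L M), (((i, kv), σ), 1)] with hX
  set R : HubbardGrassmann L M → TorusSite 2 L → ℂ := fun F kv => kernel ℂ F 2 (X kv) with hR
  set W₁ := effAction ℂ (normalCovariance L M s₁) (hubbardInteraction L M β U + counterQuadratic L M β K) with hW₁
  set W₀ := effAction ℂ (normalCovariance L M s₀) (hubbardInteraction L M β U + counterQuadratic L M β K) with hW₀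
  -- the endpoint difference and its phases
  set Rd : TorusSite 2 L → ℂ := fun x => torusFourierInv (fun kv => R W₁ kv - R W₀ kv) x with hRd
  set u : TorusSite 2 L → ℂ := fun x => conj (Rd x) / (‖Rd x‖ : ℂ) with hu
  have hu1 : ∀ x, ‖u x‖ ≤ 1 := fun x => norm_conj_div_norm_le_one (Rd x)
  -- the phase-weighted functional
  let Φ : HubbardGrassmann L M →ₗ[ℂ] ℂ :=
    { toFun := fun F => ∑ x, (w x : ℂ) * u x * torusFourierInv (R F) x
      map_add' := fun F G => by
        rw [← sum_add_distrib]
        refine sum_congr rfl fun x _ => ?_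
        rw [show R (F + G) = fun kv => R F kv + R G kv from funext fun kv => kernel_add ℂ F G 2 (X kv), torusFourierInv_add]
        ring
      map_smul' := fun c F => by
        rw [RingHom.id_apply, smul_eq_mul, mul_sum]
        refine sum_congr rfl fun x _ => ?_
        rw [show R (c • F) = fun kv => c * R F kv from funext fun kv => kernel_smul ℂ c F 2 (X kv), torusFourierInv_const_mul]
        ring }
  have hΦapply : ∀ F, Φ F = ∑ x, (w x : ℂ) * u x * torusFourierInv (R F) x := fun F => rfl
  have hΦ1 : Φ 1 = 0 := by
    rw [hΦapply]
    refine sum_eq_zero fun x _ => ?_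
    have h1 : R 1 = fun _ => 0 := funext fun kv => by
      show kernel ℂ (1 : HubbardGrassmann L M) 2 (X kv) = 0
      rw [kernel_def, iterDeriv_succ_apply, grassmannDeriv_one, map_zero, map_zero, mul_zero]
    rw [h1, show torusFourierInv (fun _ : TorusSite 2 L => (0 : ℂ)) x = 0 by simp [torusFourierInv_eq_sum_torusChar], mul_zero]
  have hΦle : ∀ F, ‖Φ F‖ ≤ ∑ x, w x * ‖torusFourierInv (R F) x‖ := fun F => by
    rw [hΦapply]; exact norm_sum_weight_phase_mul_le hw0 hu1 _
  -- the endpoint value of `Φ` IS the weighted moment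
  have hval : Φ W₁ - Φ W₀ = ((∑ x, w x * ‖Rd x‖ : ℝ) : ℂ) := by
    rw [← map_sub, hΦapply]
    push_cast
    refine sum_congr rfl fun x _ => ?_
    rw [show R (W₁ - W₀) = fun kv => R W₁ kv - R W₀ kv from funext fun kv => by
        show kernel ℂ (W₁ - W₀) 2 (X kv) = _; rw [sub_eq_add_neg, kernel_add, ← neg_one_smul ℂ W₀, kernel_smul]; ring,
      mul_assoc, show torusFourierInv (fun kv => R W₁ kv - R W₀ kv) x = Rd x from rfl, conj_div_norm_mul_self]
  have hgoal : ∑ x, w x * ‖Rd x‖ = ‖Φ W₁ - Φ W₀‖ := by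
    rw [hval, Complex.norm_real, Real.norm_of_nonneg (sum_nonneg fun x _ => mul_nonneg (hw0 x) (norm_nonneg _))]
  show ∑ x, w x * ‖Rd x‖ ≤ _
  rw [hgoal]
  have hV0 := constPart_hubbardInteraction_add_counterQuadratic (L := L) (M := M) β U K
  have hVe : hubbardInteraction L M β U + counterQuadratic L M β K ∈ evenOdd ℂ (ι := HubbardFieldIdx L M) 0 :=
    hubbardInteraction_add_counterQuadratic_mem_evenOdd_zero β U K
  refine norm_apply_effAction_sub_le_of_linePath (normalCovariance L M s₀) (normalCovariance L M s₁) hV0 hVe hZ Φ hΦ1 ?_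
  intro t ht
  have hNt := hN₂ t ht
  have hSt := hS t ht
  rw [normalCovariance_linePath, normalCovariance_sub]
  rw [normalCovariance_linePath] at hNt hSt
  set st : FreqMomentum L M × Fin 2 → ℂ := fun p => s₀ p + (t : ℂ) * (s₁ p - s₀ p) with hst
  set W := effAction ℂ (normalCovariance L M st) (hubbardInteraction L M β U + counterQuadratic L M β K) with hW
  -- loop term, bare vertex split off SIGNED
  have hloop : ‖Φ (grassmannLaplacian ℂ (normalCovariance L M fun p => s₁ p - s₀ p) W)‖ ≤
      12 * (∑ p, ‖s₁ p - s₀ p‖) * N₂ + w 0 * (|U| / |β * (L : ℝ) ^ 2| ^ 3) * Ss :=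
    (hΦle _).trans (covResp_moment_kernel_two_laplacian_le_split (fun p => s₁ p - s₀ p) W β U i σ hw0 hNt hSs)
  -- tree term: pointwise a product
  have htree : R (grassmannDerivPairing ℂ (normalCovariance L M fun p => s₁ p - s₀ p) W W) =
      fun kv => 4 * ((s₁ ((i, kv), σ) - s₀ ((i, kv), σ)) * R W kv ^ 2) := funext fun kv => by
    show kernel ℂ _ 2 (X kv) = _
    rw [hX]
    simp only
    rw [covRespCT_kernel_two_pairing_eq β U K (fun p => s₁ p - s₀ p) st ((i, kv), σ)]
    ring
  have hS0 : 0 ≤ S := (sum_nonneg fun x _ => mul_nonneg (hw0 x) (norm_nonneg _)).trans hSt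
  have hD0 : 0 ≤ D := (sum_nonneg fun x _ => mul_nonneg (hw0 x) (norm_nonneg _)).trans hD
  have htree_le : ‖(2 : ℂ)⁻¹ * Φ (grassmannDerivPairing ℂ (normalCovariance L M fun p => s₁ p - s₀ p) W W)‖ ≤ 2 * D * S ^ 2 := by
    rw [norm_mul, norm_inv, RCLike.norm_ofNat]
    have h1 := hΦle (grassmannDerivPairing ℂ (normalCovariance L M fun p => s₁ p - s₀ p) W W)
    rw [htree] at h1
    simp_rw [torusFourierInv_const_mul, norm_mul, RCLike.norm_ofNat] at h1
    have h2 := sum_mul_norm_torusFourierInv_mul_sq_le hw0 hw (fun kv : TorusSite 2 L => s₁ ((i, kv), σ) - s₀ ((i, kv), σ)) (R W)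
    have hSW : ∑ x, w x * ‖torusFourierInv (R W) x‖ ≤ S := hSt
    have h3 : ∑ x, w x * ‖torusFourierInv (fun kv : TorusSite 2 L => (s₁ ((i, kv), σ) - s₀ ((i, kv), σ)) * R W kv ^ 2) x‖ ≤ D * S ^ 2 :=
      h2.trans (mul_le_mul hD (pow_le_pow_left₀ (sum_nonneg fun x _ => mul_nonneg (hw0 x) (norm_nonneg _)) hSW 2)
        (sq_nonneg _) hD0)
    calc 2⁻¹ * ‖Φ (grassmannDerivPairing ℂ (normalCovariance L M fun p => s₁ p - s₀ p) W W)‖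
        ≤ 2⁻¹ * ∑ x, w x * (4 * ‖torusFourierInv (fun kv : TorusSite 2 L => (s₁ ((i, kv), σ) - s₀ ((i, kv), σ)) * R W kv ^ 2) x‖) :=
          mul_le_mul_of_nonneg_left h1 (by norm_num)
      _ = 2 * ∑ x, w x * ‖torusFourierInv (fun kv : TorusSite 2 L => (s₁ ((i, kv), σ) - s₀ ((i, kv), σ)) * R W kv ^ 2) x‖ := by
          rw [mul_sum, mul_sum]; exact sum_congr rfl fun x _ => by ring
      _ ≤ 2 * (D * S ^ 2) := mul_le_mul_of_nonneg_left h3 (by norm_num)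
      _ = 2 * D * S ^ 2 := by ring
  calc ‖Φ (grassmannLaplacian ℂ (normalCovariance L M fun p => s₁ p - s₀ p) W) -
        (2 : ℂ)⁻¹ * Φ (grassmannDerivPairing ℂ (normalCovariance L M fun p => s₁ p - s₀ p) W W)‖
      ≤ ‖Φ (grassmannLaplacian ℂ (normalCovariance L M fun p => s₁ p - s₀ p) W)‖ +
          ‖(2 : ℂ)⁻¹ * Φ (grassmannDerivPairing ℂ (normalCovariance L M fun p => s₁ p - s₀ p) W W)‖ := norm_sub_le _ _
    _ ≤ 12 * (∑ p, ‖s₁ p - s₀ p‖) * N₂ + w 0 * (|U| / |β * (L : ℝ) ^ 2| ^ 3) * Ss + 2 * D * S ^ 2 := add_le_add hloop htree_le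


end Summit.HubbardSuperconductivity.HubbardSuperconductivity.Theorems.EngineV8

end
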